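import Summits.BirchSwinnertonDyer.BirchSwinnertonDyer.Theorems.CMKolyvaginAtInertTwoConjugationTypeAtTwo
import Literature.NumberTheory.EllipticCurves.HeegnerPointsKolyvaginPrimaryProp82Proofs
import HarnessLib

/-!
# Route `CMKolyvaginAtInertTwo`, crux `CMKolyvaginExactAtInertTwo` (stmt-BirchSwinnertonDyer-24277):
# transposition-type data on `E(K̄)[q]` at a Kolyvagin prime (`2 ∣ q`, `Δ_E < 0`) — the inputs
# `#E(K̄)[q][2] = 4` and "a `2`-torsion vector moved by the Frobenius lift" of the sharp descent step

Seat `bsd-line-cmk2-p1` g6 (cell `bsd-print-cf2`); helper (`--supports stmt-BirchSwinnertonDyer-24277`).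
THEOREMS ONLY: no definition, no named fact, no `sorry`; no item is closed; BSD is not proved by this.

`card_twoTorsion_and_exists_moved_of_smul_eq` — for `W/ℚ` elliptic with `Δ(W) < 0`, `K` a number
field, `c ∈ Aut(K/ℚ)`, `h ∈ Γ_ℚ` whose transport `T` to `K̄` lifts `c`, `c₀ ∈ Γ_ℚ` a complex
conjugation with `h = c₀` on `E(ℚ̄)[q]` (Gross's (3.2) datum of a Kolyvagin prime), and `2 ∣ q`:
(i) `#{x ∈ E(K̄)[q] : 2x = 0} = 4`; (ii) some `v₁ ∈ E(K̄)[q]` with `2v₁ = 0` is MOVED by `T_*`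
(transport of g2's `KolyvaginEigenTwo.exists_twoTorsion_smul_ne_of_Δ_neg`: complex conjugation moves a
point of `E(ℚ̄)[2]` when `Δ < 0`). This is the odd-`p` template's "eigenvectors of `c₀` on `E[p] ⊂ E[q]`"
block (`lemma_5_3_descent_of_reciprocity`, Step 8) at `p = 2`, packaged for
`KolyvaginDescentTwo.lemma_5_3_descent_two_pow`. [SilvermanAEC2009] III.1; [GrossLMS1991] §3 (3.2).
-/

-- single-conjunct summit: `Summit.BirchSwinnertonDyer.BirchSwinnertonDyer.…` repeats the name by design
set_option linter.dupNamespace false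
set_option autoImplicit false

noncomputable section

open scoped Classical Pointwise
open WeierstrassCurve NumberField IsDedekindDomain Field
open Literature.NumberTheory.GaloisRepresentations Literature.NumberTheory.EllipticCurves
open Summit.BirchSwinnertonDyer.BirchSwinnertonDyer.Theorems.KolyvaginEigenTwo

universe u

namespace Summit.BirchSwinnertonDyer.BirchSwinnertonDyer.Theorems.KolyvaginDescentTwo

variable (W : WeierstrassCurve ℚ) {K : Type u} [Field K] [NumberField K]

/-- **Transposition-type data on `E(K̄)[q]`** (`2 ∣ q`, `Δ < 0`): for `h ∈ Γ_ℚ` acting on `E(ℚ̄)[q]`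
as the complex conjugation `c₀`, with transport `T` to `K̄` lifting `c ∈ Aut(K/ℚ)`:
`#\{x ∈ E(K̄)[q] : 2x = 0\} = 2²`, and some `2`-torsion `v₁ ∈ E(K̄)[q]` has `T_* v₁ ≠ v₁`
(inclusion `E(K̄)[2] ↪ E(K̄)[q]`, the `Γ`-equivariant identification `E(ℚ̄)[·] ≃ E(K̄)[·]`, and g2's
`exists_twoTorsion_smul_ne_of_Δ_neg`). [cite: SilvermanAEC2009, III.1] [cite: GrossLMS1991, §3 (3.2)] -/
theorem card_twoTorsion_and_exists_moved_of_smul_eq [W.IsElliptic] (hΔ : W.Δ < 0)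
    {c : K ≃ₐ[ℚ] K} {h c₀ : absoluteGaloisGroup ℚ}
    (ht : IsLiftOfAut c ((absGaloisTransport (K := ℚ) (L := K)) h).toRingEquiv)
    (hc₀ : IsComplexConjugation (Rat.castHom ℝ) c₀) {q : ℕ} (h2q : 2 ∣ q)
    (hE : ∀ P : geomTorsion W q, h • P = c₀ • P) :
    Nat.card {x : geomTorsion (W.baseChange K) q // 2 • x = 0} = 2 ^ 2 ∧
      ∃ v₁ : geomTorsion (W.baseChange K) q, 2 • v₁ = 0 ∧ ht.torsionMap W q v₁ ≠ v₁ := by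
  set p : ℕ := 2 with hpdef
  have hp : p.Prime := Nat.prime_two
  -- `h = c₀` on `E(ℚ̄)[p] ⊆ E(ℚ̄)[q]`
  have hEp : ∀ P : geomTorsion W p, h • P = c₀ • P := fun P ↦ by
    have hPq : ((q : ℕ) : ℤ) • (P : geomPoints W) = 0 := by
      obtain ⟨m, hm⟩ := h2q
      rw [hm, Nat.cast_mul, mul_comm, mul_smul, (mem_geomTorsion_iff W p _).mp P.2, smul_zero]
    have h1 := congrArg Subtype.val (hE ⟨P.1, (mem_geomTorsion_iff W q _).mpr hPq⟩)
    rw [AddSubgroup.torsionBy.coe_smul, AddSubgroup.torsionBy.coe_smul] at h1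
    apply Subtype.ext
    rw [AddSubgroup.torsionBy.coe_smul, AddSubgroup.torsionBy.coe_smul]
    exact h1
  -- the inclusion `E(K̄)[p] ↪ E(K̄)[q]` and the identification `θp : E(ℚ̄)[p] ≃ E(K̄)[p]`
  set θp := RatClosure.torsionEquiv (K := K) W (p : ℤ) with hθp
  have hinclmem : ∀ Q : geomTorsion (W.baseChange K) p,
      ((q : ℕ) : ℤ) • (Q : geomPoints (W.baseChange K)) = 0 := fun Q ↦ by
    obtain ⟨m, hm⟩ := h2q
    rw [hm, Nat.cast_mul, mul_comm, mul_smul, (mem_geomTorsion_iff _ p _).mp Q.2, smul_zero]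
  set incl : geomTorsion (W.baseChange K) p → geomTorsion (W.baseChange K) q :=
    fun Q ↦ ⟨Q.1, (mem_geomTorsion_iff _ q _).mpr (hinclmem Q)⟩ with hincl
  have hincl_inj : Function.Injective incl := fun Q Q' hQ ↦ Subtype.ext
    (congrArg (fun R : geomTorsion (W.baseChange K) (q : ℤ) ↦ (R : geomPoints (W.baseChange K)))
      hQ)
  have hincl_p : ∀ Q, p • incl Q = 0 := fun Q ↦ Subtype.ext (by
    rw [AddSubgroupClass.coe_nsmul, ZeroMemClass.coe_zero]
    change p • (Q : geomPoints (W.baseChange K)) = 0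
    rw [← natCast_zsmul]
    exact (mem_geomTorsion_iff _ p _).mp Q.2)
  have hιincl : ∀ Q, ht.torsionMap W q (incl Q) = incl (ht.torsionMap W p Q) := fun Q ↦ by
    apply Subtype.ext
    simp only [hincl, IsLiftOfAut.coe_torsionMap]
  have hθpT : ∀ P : geomTorsion W p, ht.torsionMap W p (θp P) = θp (c₀ • P) := fun P ↦ by
    rw [← hEp, ← RatClosure.torsionEquiv_smul_of_lift W ht h (fun _ ↦ rfl) p P]
  -- (i) the `2`-torsion count
  have hcardKp : Nat.card (geomTorsion (W.baseChange K) p) = p ^ 2 :=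
    card_torsionPoints_eq_sq_holds (W.baseChange K) (AlgebraicClosure K)
      (by exact_mod_cast hp.ne_zero)
  have hcardp : Nat.card {x : geomTorsion (W.baseChange K) q // p • x = 0} = p ^ 2 := by
    refine Eq.trans (Nat.card_congr ?_) hcardKp
    exact
      { toFun := fun x ↦ ⟨x.1.1, (mem_geomTorsion_iff _ p _).mpr (by
          have h1 := congrArg Subtype.val x.2
          rw [AddSubgroupClass.coe_nsmul, ZeroMemClass.coe_zero, ← natCast_zsmul] at h1
          exact h1)⟩
        invFun := fun Q ↦ ⟨incl Q, hincl_p Q⟩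
        left_inv := fun x ↦ Subtype.ext (Subtype.ext rfl)
        right_inv := fun Q ↦ Subtype.ext rfl }
  -- (ii) a moved `2`-torsion vector
  obtain ⟨v, hv⟩ : ∃ v : geomTorsion W p, c₀ • v ≠ v := by
    obtain ⟨v, hv⟩ := exists_twoTorsion_smul_ne_of_Δ_neg W hΔ hc₀
    exact ⟨v, hv⟩
  refine ⟨hcardp, incl (θp v), hincl_p (θp v), fun h0 ↦ hv ?_⟩
  rw [hιincl, hθpT] at h0
  exact θp.injective (hincl_inj h0)

end Summit.BirchSwinnertonDyer.BirchSwinnertonDyer.Theorems.KolyvaginDescentTwo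

end
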